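import Mathlib
import Literature.RepresentationTheory.FiniteGroups.InducedClassFunction
import Literature.RepresentationTheory.FiniteGroups.BrauerInduction
import Literature.RepresentationTheory.FiniteGroups.BrauerTheorem
import Literature.RepresentationTheory.FiniteGroups.MonomialRepresentation
import Literature.RepresentationTheory.FiniteGroups.GLnUnipotent
import Literature.RepresentationTheory.FiniteGroups.GLnBruhat
import Summits.MatrixMultiplication.MatrixMultiplication.Theorems.LieRankDesigns.Negative.Basics
import Summits.MatrixMultiplication.MatrixMultiplication.Theorems.LevelGradedCohnUmansLieRankDesignsStubLevelOfFixedVector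
import Summits.MatrixMultiplication.MatrixMultiplication.Theorems.SubgroupIdentityDesigns.Negative.BorelLevelOne
import Summits.MatrixMultiplication.MatrixMultiplication.Theorems.SubgroupIdentityDesigns.Negative.GrassmannCharacter
import Summits.MatrixMultiplication.MatrixMultiplication.Theorems.SubgroupIdentityDesigns.Negative.GrassmannOrbits

/-!
# The permutation character of `GL_{k+l}(F)` on partial flags of type `(1^k; l)`

Groundwork for a SHARPER general-`k` budget lemma for the crux `SubgroupIdentityDesigns`
(stmt-MatrixMultiplication-14079; BLOCK-SLICES §2).  VALUE = theorem, NOT summit progress.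

`GrassmannNoGo` / `BlockSliceGeneral` use `Φ_k = Ind_{P_k}^G 1` (`P_k` = stabiliser of the standard
`k`-subspace), whose degree `≈ p^{kl}` loses the factor `p^{k(k-1)/2}` of the hook character of
BLOCK-SLICES Lemma 2.1; this costs the window `l < 3k + 6`.  Here we replace `P_k` by the smaller
parabolic `P' = flagStab F k l` = stabiliser of the standard partial flag
`⟨e_1⟩ ⊂ ⟨e_1, e_2⟩ ⊂ ⋯ ⊂ ⟨e_1, …, e_k⟩`, i.e. the block upper triangular matrices of type
`(1, …, 1, l)` (`Matrix.BlockTriangular` for the labelling `i ↦ min i k`), and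
`Ψ = flagChar F k l = Ind_{P'}^G 1`:
* `mem_flagStab_iff'` — membership = lower-left `l × k` block zero and upper-left block upper
  triangular; `flagStab_le` — `P' ≤ P_k`; `mem_flagStab_iff_frame` — `h ∈ P' ↔ h E = E A` with `A`
  upper triangular (`E` the standard `n × k` frame);
* `flagChar_apply` (`Ψ(y) = #` fixed cosets), `flagChar_apply_eq_sum` (frame expansion with upper
  triangular coefficient matrices), hence **`flagChar_mem_levelSet`**: `Ψ ∈ F_k` over `𝔽_p`;
* `flagChar_one` (`Ψ(1) = [G : P']`);
* Bruhat side: `unitUpper_le_flagStab`, `permGL_mem_flagStab` (permutation matrices fixing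
  `e_1, …, e_k` lie in `P'`), `exists_perm_orbit` (every coset `gP'` is `P'`-equivalent to a
  permutation coset `w(τ)P'`, from the tree's `GLn.exists_bruhat`).
The orbit count `⟨Ψ,Ψ⟩ ≤ (k+1)^k`, the degree bound `Ψ(1) ≥ p^{kl + k(k-1)/2}` and the resulting
no-go for `l ≥ 3 + 6⌈log₂(k+1)⌉` are in the sequel files.
-/

set_option linter.dupNamespace false

noncomputable section

open scoped BigOperators Matrix Classical
open Literature.RepresentationTheory.FiniteGroups
open Literature.RepresentationTheory.FiniteGroups.GLn (unitUpper exists_bruhat)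
open Summit.MatrixMultiplication.MatrixMultiplication.Theorems.LieRankDesigns.Negative
  (GLm Mat levelSet)
open Summit.MatrixMultiplication.MatrixMultiplication.Theorems.LieRankDesigns.LevelOfFixedVector
  (sum_mem_levelSet)

namespace Summit.MatrixMultiplication.MatrixMultiplication.Theorems.SubgroupIdentityDesigns.Negative
namespace FlagCharacter

open GrassmannCharacter (subspaceStab mem_subspaceStab_iff stdFrame mul_stdFrame_apply
  castAdd_ne_natAdd stdFrame_mul_castAdd stdFrame_mul_natAdd mem_subspaceStab_iff_frame
  conj_frame_iff frame_coeff_unique)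
open GrassmannOrbits (permGL permGL_apply permGL_mul permGL_one permGL_inv permGL_mul_apply)

section General

variable {F : Type} [Field F] [Fintype F] [DecidableEq F] {k l : ℕ}

/-! ## The parabolic `P'` of type `(1^k; l)` -/

/-- Block labels `i ↦ min i k`: the first `k` indices are singleton blocks, the last `l` one block.
    -/
def blk (k l : ℕ) (i : Fin (k + l)) : ℕ := min (i : ℕ) k

/-- `P' = flagStab F k l`: block upper triangular matrices of type `(1, …, 1, l)`, the stabiliser
of the standard partial flag `⟨e_1⟩ ⊂ ⋯ ⊂ ⟨e_1, …, e_k⟩`. -/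
def flagStab (F : Type) [Field F] [DecidableEq F] (k l : ℕ) : Subgroup (GL (Fin (k + l)) F) where
  carrier := {g | ((g : GL (Fin (k + l)) F) : Matrix (Fin (k + l)) (Fin (k + l)) F).BlockTriangular
    (blk k l)}
  one_mem' := by
    show ((1 : GL (Fin (k + l)) F) : Matrix (Fin (k + l)) (Fin (k + l)) F).BlockTriangular _
    rw [Units.val_one]
    exact Matrix.blockTriangular_one
  mul_mem' {a b} ha hb := by
    show ((a * b : GL (Fin (k + l)) F) : Matrix (Fin (k + l)) (Fin (k + l)) F).BlockTriangular _
    rw [Units.val_mul]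
    exact ha.mul hb
  inv_mem' {a} ha := by
    show ((a⁻¹ : GL (Fin (k + l)) F) : Matrix (Fin (k + l)) (Fin (k + l)) F).BlockTriangular _
    rw [Matrix.coe_units_inv]
    letI : Invertible ((a : GL (Fin (k + l)) F) : Matrix (Fin (k + l)) (Fin (k + l)) F) :=
      a.invertible
    exact Matrix.blockTriangular_inv_of_blockTriangular ha

omit [Fintype F] in
/-- Membership in `P'` (definition). -/
theorem mem_flagStab_iff (g : GL (Fin (k + l)) F) :
    g ∈ flagStab F k l ↔ ∀ i j : Fin (k + l), blk k l j < blk k l i →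
      (g : Matrix (Fin (k + l)) (Fin (k + l)) F) i j = 0 :=
  Iff.rfl

omit [Fintype F] in
/-- Membership in `P'`, concretely: the lower-left `l × k` block vanishes and the upper-left
`k × k` block is upper triangular. -/
theorem mem_flagStab_iff' (g : GL (Fin (k + l)) F) :
    g ∈ flagStab F k l ↔
      (∀ (i : Fin l) (j : Fin k), (g : Matrix (Fin (k + l)) (Fin (k + l)) F) (Fin.natAdd k i)
          (Fin.castAdd l j) = 0) ∧
      ∀ i j : Fin k, j < i → (g : Matrix (Fin (k + l)) (Fin (k + l)) F) (Fin.castAdd l i)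
          (Fin.castAdd l j) = 0 := by
  rw [mem_flagStab_iff]
  constructor
  · intro h
    refine ⟨fun i j => h _ _ ?_, fun i j hij => h _ _ ?_⟩
    · have := j.isLt
      simp only [blk, Fin.val_natAdd, Fin.val_castAdd]
      omega
    · have := i.isLt
      have hij' : (j : ℕ) < i := hij
      simp only [blk, Fin.val_castAdd]
      omega
  · rintro ⟨h1, h2⟩ i j hij
    induction i using Fin.addCases with
    | left i =>
      induction j using Fin.addCases with
      | left j =>
        have hi := i.isLt
        have hj := j.isLt
        refine h2 i j ?_
        show (j : ℕ) < i
        simp only [blk, Fin.val_castAdd] at hij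
        omega
      | right j =>
        have := i.isLt
        simp only [blk, Fin.val_castAdd, Fin.val_natAdd] at hij
        omega
    | right i =>
      induction j using Fin.addCases with
      | left j => exact h1 i j
      | right j =>
        simp only [blk, Fin.val_natAdd] at hij
        omega

omit [Fintype F] in
/-- `P' ≤ P_k` (the flag stabiliser stabilises its top subspace). -/
theorem flagStab_le : flagStab F k l ≤ subspaceStab F k l := fun g hg =>
  (mem_subspaceStab_iff g).mpr ((mem_flagStab_iff' g).mp hg).1

omit [Fintype F] in
/-- **`h ∈ P' ↔ h E = E A` for an upper triangular `k × k` matrix `A`.** -/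
theorem mem_flagStab_iff_frame (h : GL (Fin (k + l)) F) :
    h ∈ flagStab F k l ↔ ∃ A : Matrix (Fin k) (Fin k) F, (∀ i j : Fin k, j < i → A i j = 0) ∧
      (h : Matrix (Fin (k + l)) (Fin (k + l)) F) * stdFrame F k l = stdFrame F k l * A := by
  constructor
  · intro hP
    obtain ⟨A, hA⟩ := (mem_subspaceStab_iff_frame h).mp (flagStab_le hP)
    refine ⟨A, fun i j hij => ?_, hA⟩
    rw [← stdFrame_mul_castAdd (l := l) A i j, ← hA, mul_stdFrame_apply]
    exact ((mem_flagStab_iff' h).mp hP).2 i j hij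
  · rintro ⟨A, hA, hE⟩
    refine (mem_flagStab_iff' h).mpr ⟨(mem_subspaceStab_iff h).mp
      ((mem_subspaceStab_iff_frame h).mpr ⟨A, hE⟩), fun i j hij => ?_⟩
    rw [← mul_stdFrame_apply (h : Matrix (Fin (k + l)) (Fin (k + l)) F), hE, stdFrame_mul_castAdd]
    exact hA i j hij

omit [Fintype F] in
/-- `y` fixes the coset `q = xP'` iff `y (x E) = (x E) A` for an upper triangular `A`. -/
theorem smul_eq_iff_frame (y : GL (Fin (k + l)) F) (q : GL (Fin (k + l)) F ⧸ flagStab F k l) :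
    y • q = q ↔ ∃ A : Matrix (Fin k) (Fin k) F, (∀ i j : Fin k, j < i → A i j = 0) ∧
      (y : Matrix (Fin (k + l)) (Fin (k + l)) F) *
          (((q.out : GL (Fin (k + l)) F) : Matrix (Fin (k + l)) (Fin (k + l)) F) * stdFrame F k l) =
        ((q.out : GL (Fin (k + l)) F) : Matrix (Fin (k + l)) (Fin (k + l)) F) * stdFrame F k l * A
    := by
  rw [smul_eq_self_iff_mem _ y q, mem_flagStab_iff_frame]
  exact exists_congr fun A => and_congr Iff.rfl (conj_frame_iff _ _ A)

/-- `[y • q = q] = ∑_{A upper triangular} [y X_q = X_q A]`, `X_q = q.out E`. -/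
theorem ite_smul_eq_sum (y : GL (Fin (k + l)) F) (q : GL (Fin (k + l)) F ⧸ flagStab F k l) :
    (if y • q = q then (1 : ℂ) else 0) =
      ∑ A ∈ (Finset.univ.filter fun A : Matrix (Fin k) (Fin k) F => ∀ i j : Fin k, j < i → A i j =
          0),
        (if (y : Matrix (Fin (k + l)) (Fin (k + l)) F) *
            (((q.out : GL (Fin (k + l)) F) : Matrix (Fin (k + l)) (Fin (k + l)) F) * stdFrame F k
                l) =
            ((q.out : GL (Fin (k + l)) F) : Matrix (Fin (k + l)) (Fin (k + l)) F) * stdFrame F k l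
                * A
          then (1 : ℂ) else 0) := by
  by_cases h : y • q = q
  · obtain ⟨A, hA, hE⟩ := (smul_eq_iff_frame y q).mp h
    rw [if_pos h, Finset.sum_eq_single A]
    · rw [if_pos hE]
    · intro A' _ hA'
      rw [if_neg]
      intro h'
      exact hA' (frame_coeff_unique _ (hE.symm.trans h')).symm
    · intro hA'
      exact absurd (Finset.mem_filter.mpr ⟨Finset.mem_univ A, hA⟩) hA'
  · rw [if_neg h]
    refine (Finset.sum_eq_zero fun A hA => ?_).symm
    rw [if_neg]
    exact fun hE => h ((smul_eq_iff_frame y q).mpr ⟨A, (Finset.mem_filter.mp hA).2, hE⟩)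

/-! ## The permutation character `Ψ = Ind_{P'}^G 1` -/

/-- `Ψ = Ind_{P'}^G 1`, the permutation character of `GL_{k+l}(F)` on partial flags of type
`(1^k; l)`. -/
def flagChar (F : Type) [Field F] [Fintype F] [DecidableEq F] (k l : ℕ) : GL (Fin (k + l)) F → ℂ :=
  indClassFun (flagStab F k l) (fun _ => (1 : ℂ))

/-- `Ψ` is a character (of the monomial representation `Ind_{P'}^G 1`). -/
theorem isCharacter_flagChar : IsCharacter (GL (Fin (k + l)) F) (flagChar F k l) := by
  have h : (fun h : flagStab F k l => (((1 : flagStab F k l →* ℂˣ) h : ℂˣ) : ℂ)) = fun _ => 1 :=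
    funext fun h => by simp
  have := isCharacter_indClassFun_monoidHom (flagStab F k l) 1
  rw [h] at this
  exact this

/-- `Ψ(y) = ∑_q [y • q = q]` (number of fixed flags). -/
theorem flagChar_apply (y : GL (Fin (k + l)) F) :
    flagChar F k l y = ∑ q : GL (Fin (k + l)) F ⧸ flagStab F k l, (if y • q = q then (1 : ℂ) else 0)
    := by
  unfold flagChar
  rw [indClassFun_eq_sum_quotient _ (fun _ _ => rfl)]
  refine Finset.sum_congr rfl fun q _ => ?_
  by_cases hq : y • q = q
  · rw [if_pos hq]
    exact extend_subtypeVal_apply _ _ ⟨_, (smul_eq_self_iff_mem _ y q).mp hq⟩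
  · rw [if_neg hq]
    exact extend_subtypeVal_of_not_mem _ _ fun hm => hq ((smul_eq_self_iff_mem _ y q).mpr hm)

/-- **Frame expansion** `Ψ(y) = ∑_q ∑_{A upper triangular} [y X_q = X_q A]`. -/
theorem flagChar_apply_eq_sum (y : GL (Fin (k + l)) F) :
    flagChar F k l y = ∑ q : GL (Fin (k + l)) F ⧸ flagStab F k l,
      ∑ A ∈ (Finset.univ.filter fun A : Matrix (Fin k) (Fin k) F => ∀ i j : Fin k, j < i → A i j =
          0),
        (if (y : Matrix (Fin (k + l)) (Fin (k + l)) F) *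
            (((q.out : GL (Fin (k + l)) F) : Matrix (Fin (k + l)) (Fin (k + l)) F) * stdFrame F k
                l) =
            ((q.out : GL (Fin (k + l)) F) : Matrix (Fin (k + l)) (Fin (k + l)) F) * stdFrame F k l
                * A
          then (1 : ℂ) else 0) := by
  rw [flagChar_apply]
  exact Finset.sum_congr rfl fun q _ => ite_smul_eq_sum y q

/-- `Ψ(1) = [G : P']`. -/
theorem flagChar_one :
    flagChar F k l 1 = (Fintype.card (GL (Fin (k + l)) F ⧸ flagStab F k l) : ℂ) := by
  rw [flagChar_apply]
  simp only [one_smul, if_true, Finset.sum_const, Finset.card_univ, nsmul_eq_mul, mul_one]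

/-- `Ψ 1 ≠ 0`. -/
theorem flagChar_one_ne_zero : flagChar F k l 1 ≠ 0 := by
  rw [flagChar_one, Nat.cast_ne_zero]
  exact Fintype.card_ne_zero

/-! ## Bruhat: permutation representatives of the `P'`-orbits on `G/P'` -/

omit [Fintype F] in
/-- Upper unitriangular matrices lie in `P'`. -/
theorem unitUpper_le_flagStab : unitUpper F (k + l) ≤ flagStab F k l := by
  intro g hg
  rw [mem_flagStab_iff]
  intro i j hij
  refine hg.1 _ _ ?_
  rw [Fin.lt_def]
  by_contra hle
  have : blk k l i ≤ blk k l j := min_le_min_right k (not_lt.mp hle)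
  omega

omit [Fintype F] in
/-- A permutation matrix fixing `e_1, …, e_k` lies in `P'`. -/
theorem permGL_mem_flagStab {α : Equiv.Perm (Fin (k + l))}
    (hα : ∀ j : Fin k, α (Fin.castAdd l j) = Fin.castAdd l j) :
    (permGL α : GL (Fin (k + l)) F) ∈ flagStab F k l := by
  rw [mem_flagStab_iff]
  intro i j hij
  rw [permGL_apply, if_neg]
  intro h
  induction j using Fin.addCases with
  | left j =>
    rw [hα j] at h
    rw [h] at hij
    exact lt_irrefl _ hij
  | right j =>
    have h1 : blk k l i ≤ k := min_le_right _ _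
    simp only [blk, Fin.val_natAdd] at hij h1
    omega

omit [Fintype F] in
/-- **Bruhat**: every coset `gP'` is `P'`-equivalent to a permutation coset `w(τ)P'`. -/
theorem exists_perm_orbit (x : GL (Fin (k + l)) F) :
    ∃ τ : Equiv.Perm (Fin (k + l)), ∃ s : flagStab F k l,
      s • ((permGL τ : GL (Fin (k + l)) F) : GL (Fin (k + l)) F ⧸ flagStab F k l) =
        (x : GL (Fin (k + l)) F ⧸ flagStab F k l) := by
  obtain ⟨u₁, hu₁, u₂, hu₂, σ, d, hm⟩ := exists_bruhat x
  have ht : (permGL σ : GL (Fin (k + l)) F)⁻¹ * (u₁ * x * u₂) ∈ flagStab F k l := by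
    rw [permGL_inv, mem_flagStab_iff]
    intro i j hij
    rw [Units.val_mul, permGL_mul_apply, inv_inv, hm, if_neg]
    intro h
    rw [σ.injective h] at hij
    exact lt_irrefl _ hij
  refine ⟨σ, ⟨u₁⁻¹, inv_mem (unitUpper_le_flagStab hu₁)⟩, ?_⟩
  show ((((u₁⁻¹ : GL (Fin (k + l)) F) * permGL σ : GL (Fin (k + l)) F)) :
      GL (Fin (k + l)) F ⧸ flagStab F k l) = (x : GL (Fin (k + l)) F ⧸ flagStab F k l)
  refine QuotientGroup.eq.mpr ?_
  have h : ((u₁⁻¹ : GL (Fin (k + l)) F) * permGL σ)⁻¹ * x =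
      (permGL σ : GL (Fin (k + l)) F)⁻¹ * (u₁ * x * u₂) * u₂⁻¹ := by group
  show ((u₁⁻¹ : GL (Fin (k + l)) F) * permGL σ)⁻¹ * x ∈ flagStab F k l
  rw [h]
  exact mul_mem ht (inv_mem (unitUpper_le_flagStab hu₂))

end General

/-! ## Over `𝔽_p`: `Ψ ∈ F_k` -/

variable {p : ℕ} [hp : Fact p.Prime] {k l : ℕ}

/-- **`Ψ ∈ F_k`**: the permutation character on partial flags of type `(1^k; l)` has Fourier
level `≤ k` (each frame indicator `[y X = X A]` has level `≤ k`). -/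
theorem flagChar_mem_levelSet : flagChar (ZMod p) k l ∈ levelSet p (k + l) k := by
  have h : flagChar (ZMod p) k l = fun y => ∑ q : GLm p (k + l) ⧸ flagStab (ZMod p) k l,
      ∑ A ∈ (Finset.univ.filter fun A : Matrix (Fin k) (Fin k) (ZMod p) =>
          ∀ i j : Fin k, j < i → A i j = 0),
        (fun g : GLm p (k + l) => if (g : Mat p (k + l)) *
            (((q.out : GLm p (k + l)) : Mat p (k + l)) * stdFrame (ZMod p) k l) =
            ((q.out : GLm p (k + l)) : Mat p (k + l)) * stdFrame (ZMod p) k l * A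
          then (1 : ℂ) else 0) y := funext fun y => flagChar_apply_eq_sum y
  rw [h]
  exact sum_mem_levelSet _ _ fun q _ => sum_mem_levelSet _ _ fun A _ =>
    frameIndicator_mem_levelSet _ _

end FlagCharacter
end Summit.MatrixMultiplication.MatrixMultiplication.Theorems.SubgroupIdentityDesigns.Negative
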